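import Summits.CriticalPhenomena.SAWScalingLimit.Theses.SAWSpinMonotone

/-!
# Birth skeleton (BC3) for the crux `SAWSpinMonotone.ArrivalFlattening`
(crux item stmt-CriticalPhenomena-16770, rank 3 of `route-CriticalPhenomena-SAWSpinMonotone`, sub-problem
SAWScalingLimit; skeleton registrar planner-skel-stmt-CriticalPhenomena-16770-0, 2026-08-17; tree path
`Summits/CriticalPhenomena/SAWScalingLimit/Cruxes/ArrivalFlattening/Lines/birth.lean`; line card `Lines/birth.md`.)

Crux (FIXED, by name): `ArrivalFlattening` — (WCLT) of the route: for every `ε > 0` there is a depth `R` such that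
for every simply connected hexagonal domain `Λ`, boundary mid-edge `a`, vertex `v ∈ Λ` whose Euclidean `R`-ball of
vertices lies in `Λ`, and pairwise distinct neighbours `w₀ w₁ w₂` of `v`:
`‖Σᵢ G(11/8){v,wᵢ}‖ ≤ ε ‖Σᵢ G(5/8){v,wᵢ}‖`, `G s z = F_{Λ.erase v}(a, z; x_c, s)` the DCS parafermionic observable of
the PUNCTURED domain at spin `s` — the spin-`11/8` transform of the first-arrival winding law at a deep vertex is
small against its spin-`5/8` transform, uniformly in `(Λ, a)` ("|Â_v(165°)| ≤ ε|Â_v(75°)|" for ONE positive law on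
the winding classes `θ₀ + 120°ℤ`, refuter note on the item).

## The line `birth`: A-PRIORI BOUND ⊗ GEOMETRIC RATE (bootstrap over depth; 2 registered stubs)

Write `FlatAtDepth η R` for the crux's body with `ε ↦ η` (the profile predicate; the crux is literally
`∀ ε > 0, ∃ R, FlatAtDepth ε R`, `arrivalFlattening_iff : … ↔ … := Iff.rfl`).  The crux is a statement about the
RATIO of two decaying quantities (both modes are `o(mass)` at a deep vertex: `|A(s)|/A(0) ≈ R^{-c s²}`), so no
one-sided estimate against the mass decides it; what does is (i) an a-priori comparison of the two modes at SOME
depth and (ii) a RATE at which further depth improves it.  The line registers exactly these two halves: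

* S1 `stub_aprioriModeBound` (OPEN; the BASE): `AprioriModeBound` — `∃ K ≥ 0, ∃ R₁, FlatAtDepth K R₁`: beyond some
  depth the spin-`11/8` mode is at most `K` times the spin-`5/8` mode.  It is the `(5/8 ≤ 11/8)`-instance of the
  sister crux `SpinMonotone` (stmt-16769: `s ↦ ‖A_v(s)‖` antitone on `[0, 3/2]`), with `K = 1`, `R₁ = 0` — PROVED
  here: `aprioriModeBound_of_spinMonotone` — and the `ε = 1` instance of the crux (`aprioriModeBound_of_arrival
  Flattening`), hence a necessary input; it plays the role of `stub_baseDistortion` (∃ R_b K_b, D R_b K_b) of the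
  sister line `Cruxes/InteriorFlattening/Lines/z3-covariant-fixed-point`.  Alone it says: no deep configuration has
  an exact zero of the `5/8`-mode with a non-zero `11/8`-mode (the event that kills the crux AS TYPED for every `ε`,
  cf. `Cruxes/InteriorFlattening/Disproof.lean` §D for the sister quantity).  Evidence: exact enumeration of the
  route (all polyhexes ≤ 5 cells, all sources, all vertices: max ratio 0.9097, i.e. `K = 1` already at depth 0).
* S2 `stub_geometricFlattening` (OPEN, conjecture-grade; the HARDEST stub; the STEP): `GeometricFlattening` — for
  every level `K ≥ 0` there are `θ < 1`, `b > 1`, `R₀ > 0` with: `R ≥ R₀ ∧ FlatAtDepth K R ⟹ ∀ k, FlatAtDepth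
  (K θ^k) (b^k R)`.  Each further factor `b` of depth gains the factor `θ`, starting from wherever the a-priori
  bound holds: a POWER-LAW RATE `sup-ratio(R') = O(R'^{-κ})`, `κ = log(1/θ)/log b`, in the form that consumes S1.
  PROVED here: `geometricFlattening_of_powerLaw` — S2 follows from the plain bound `FlatAtDepth (C R^{-κ}) R`
  (`R ≥ R₀`), so S2 asks for NO lower bound on / regularity of the sup-ratio (a per-level contraction
  `FlatAtDepth η R → FlatAtDepth (θη) (bR)` for all `η` would: it bounds `sup-ratio(bR)/sup-ratio(R)`, a two-sided
  statement nobody needs; rejected for that reason).  Why plausibly true: every conformally invariant scenario gives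
  a power law — Gaussian winding law with `Var W ≍ c log R` (DuplantierSaleur1988; Schramm 2000 §7 for SLE) gives
  `exp(−((11/8)²−(5/8)²) Var W/2) = R^{-0.75c}`; the Coulomb-gas bookkeeping of the sister disproof
  (`Cruxes/InteriorFlattening/Disproof.lean` §C3: leading correction = the descendant `∂ψ`, Koebe distortion
  `|φ″/φ′| ≤ 4/R` uniformly over simply connected `Λ ⊇ B_R(v)`, no plateau compatible with any `c = 0` Kac table)
  gives `C/R`; numerics for the sister quantity `μ_v`: worst-root `0.683 R^{-0.760}` to `R = 96`
  (`Cruxes/InteriorFlattening/STRATEGY-CENSUS.md` §1).  Why it might fail / where it is hard: it is the common wall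
  W of the sister census ("far-field independence / spreading of the positive first-arrival turning law of
  x_c-weighted SAW at an infinitely deep vertex, uniformly over simply connected (Λ, a)", DCS arXiv:1007.0575 p. 7)
  in RATE form, for the UNDRESSED first-arrival law of this route (no rigorous winding-spread / angular-mixing rate
  exists for planar SAW at n = 0: no RSW/FKG; Kesten patterns and bridge renewal give ratio bounds, not rates).
  What is different here from the four dead lines on (M): the input this route adds is POSITIVITY/MONOTONICITY of
  the winding law in the spin (FM), isolated in S1; S2 is then a pure rate statement from a finite level, the
  shape in which a multi-scale argument (first-entrance superposition `A_{Λ,a} = Σ_{γ_out} x_c^{|γ_out|}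
  e^{-isW(γ_out)} A_{Λ∖γ_out, b}` over R-deep inner configurations of the SAME class, sister Disproof §C2, plus a
  per-annulus gain) delivers its output.

The composition (kernel-checked, sorry-free; `flatLimit_of`, then `ArrivalFlattening_of` concludes the ROUTE DECL
BY NAME from the two stubs under their registered names `__Registered.stub_*`): take `K, R₁` from S1, `θ, b, R₀`
from S2 at level `K`, move the base to `R* = max R₀ R₁` (`flatAtDepth_mono`: `FlatAtDepth` is monotone in the
constant and in the depth), get `FlatAtDepth (K θ^k) (b^k R*)` for all `k`, and choose `k` with `(K+1) θ^k < ε`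
(`exists_pow_lt_of_lt_one`); `R(ε) = b^k R*`.

Obstructions honoured.  No `Disproof.lean` exists for THIS crux yet (crux dir empty at registration).  The landed
negatives of the same-shape sister crux InteriorFlattening (stmt-8297; `Theorems/InteriorFlattening/Negative/…`,
`Cruxes/InteriorFlattening/Disproof.lean` §A) are respected by construction: DEPTH is kept in both stubs
(`FlatAtDepth _ R` carries the crux's `R`-ball hypothesis verbatim — cf. `interiorFlattening_false_without_depth`),
the QUANTIFIER ORDER `∃ R ∀ Λ` is kept (S1: `∃ R₁ ∀`; S2: depths `b^k R` fixed before the configuration — cf.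
`interiorFlatteningNonUniform_holds`: `∀ Λ ∃ R` is vacuous), SIMPLE CONNECTIVITY and `a ∈ ∂Λ` are kept.  `ledger
negatives --problem CriticalPhenomena` (11 entries, 2026-08-17): none concerns first-arrival spin transforms or mode
ratios (nearest: stmt-5420 old HexObservableLimit, corridor witness; stmt-8312 RetrievalStability) — nothing in the
stubs restates a refuted statement.

BC3 AUDIT (registrar, 2026-08-17, `lean check --json` on this file): rc 0, errors [], sorries 2 = exactly the two
`stub_*` declarations (`stub_aprioriModeBound`, `stub_geometricFlattening`), zero elsewhere; `ArrivalFlattening_of`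
has target `Summit.CriticalPhenomena.SAWScalingLimit.Theses.SAWSpinMonotone.ArrivalFlattening` (the route decl BY
NAME) under exactly the hypotheses `__Registered.stub_aprioriModeBound`, `__Registered.stub_geometricFlattening`,
axioms `propext, Classical.choice, Quot.sound` (no `sorryAx`); the sanity theorems of §6 are sorry-free.
BC3 PROBES (registrar's folder `bc/probe_<Def>_{crux,summit}.lean`, definitions inlined verbatim; each file runs,
under `set_option maxHeartbeats 400000`, the combined `first | exact? | simpa [Def] | (unfold Def; simpa) | aesop`
AND `exact?`, `simpa [Def]`, `unfold Def; simpa`, `aesop`, plain `simpa` one by one): all 24 examples FAIL — for each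
of `AprioriModeBound`, `GeometricFlattening` against BOTH `ArrivalFlattening` and `_root_.SAWScalingLimit`: combined =
"unsolved goals" after aesop's exhaustive search, `exact?` = "could not close the goal", `simpa [Def]` / `unfold Def;
simpa` / `simpa` = "Tactic `assumption` failed" with the implication as residual goal, `aesop` = "failed to prove the
goal after exhaustive search" (rc 1 for all four files).  No stub is cheaply the crux or the summit.  (Converse
directions, for the record: crux → S1 holds (`aprioriModeBound_of_arrivalFlattening`); crux ↛ S2 (S2 carries a
rate); S1 ∧ S2 → crux is the skeleton.)
-/

noncomputable section

namespace Summit.CriticalPhenomena.SAWScalingLimit.Cruxes.ArrivalFlattening.Birth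

open Literature.Probability.LatticeModels
open Literature.Probability.RandomPlanarGeometry Literature.Probability.RandomPlanarGeometry.SAW
open Summit.CriticalPhenomena.SAWScalingLimit.Theses.SAWSpinMonotone (ArrivalFlattening SpinMonotone)

set_option linter.unusedVariables false

/-! ## 1. Vocabulary of the line (local `def`s over tree declarations) -/

/-- **The first-arrival spin-`s` transform at `v`**: `A_v(s) = Σ_i F_{Λ∖v}(a, {v,wᵢ}; x_c, s)`, the critical
parafermionic observable of the punctured domain `Λ.erase v` with source `a`, summed over the three ports
`{v,w₀}, {v,w₁}, {v,w₂}` of `v` — i.e. the sum of `x_c^{ℓ(γ)} e^{-isW(γ)}` over the self-avoiding walks of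
`Λ ∖ {v}` from `a` that FIRST ARRIVE next to `v` (the quantity written `G s s(v,w₀) + G s s(v,w₁) + G s s(v,w₂)`
in the crux). -/
def arrivalTransform (Λ : Finset HexVertex) (a : Sym2 HexVertex) (v w₀ w₁ w₂ : HexVertex) (s : ℝ) : ℂ :=
  hexParafermionicObservable (Λ.erase v) a hexCriticalFugacity s s(v, w₀) +
    hexParafermionicObservable (Λ.erase v) a hexCriticalFugacity s s(v, w₁) +
    hexParafermionicObservable (Λ.erase v) a hexCriticalFugacity s s(v, w₂)

/-- **Flattening with constant `η` at depth `R`** (the crux's body with `ε ↦ η`; the "profile predicate"):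
for every simply connected `Λ`, boundary mid-edge `a`, vertex `v ∈ Λ` whose Euclidean `R`-ball of vertices lies
in `Λ`, and pairwise distinct neighbours `w₀, w₁, w₂` of `v`: `‖A_v(11/8)‖ ≤ η ‖A_v(5/8)‖`.  Antitone in `R`,
monotone in `η` (`flatAtDepth_mono`).  The crux `ArrivalFlattening` is DEFINITIONALLY `∀ ε > 0, ∃ R, FlatAtDepth ε R`
(`arrivalFlattening_iff`, by `Iff.rfl`). -/
def FlatAtDepth (η R : ℝ) : Prop :=
  ∀ (Λ : Finset HexVertex), hexDomainSimplyConnected Λ → ∀ a ∈ hexDomainBoundary Λ, ∀ v ∈ Λ,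
    (∀ w : HexVertex, dist (hexCenter w) (hexCenter v) ≤ R → w ∈ Λ) →
    ∀ w₀ w₁ w₂ : HexVertex, hexGraph.Adj v w₀ → hexGraph.Adj v w₁ → hexGraph.Adj v w₂ →
      w₀ ≠ w₁ → w₁ ≠ w₂ → w₀ ≠ w₂ →
      ‖arrivalTransform Λ a v w₀ w₁ w₂ (11 / 8)‖ ≤ η * ‖arrivalTransform Λ a v w₀ w₁ w₂ (5 / 8)‖

/-- The `ε–R` limit statement in the line's vocabulary. -/
def FlatLimit : Prop := ∀ ε : ℝ, 0 < ε → ∃ R : ℝ, FlatAtDepth ε R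

/-- The crux IS `FlatLimit` (definitional unfolding: the crux's `let G := …` ζ-reduces, `arrivalTransform`
δ-reduces). -/
theorem arrivalFlattening_iff : ArrivalFlattening ↔ FlatLimit := Iff.rfl

/-! ## 2. Statements of the two stubs -/

/-- **(B) A-priori mode bound in the bulk** (the BASE of the bootstrap; "no deep blow-up of the mode ratio"):
there are a constant `K ≥ 0` and a depth `R₁` such that `‖A_v(11/8)‖ ≤ K ‖A_v(5/8)‖` for every `R₁`-deep
configuration.  With `K = 1` and any `R₁` this is the `(5/8 ≤ 11/8)`-instance of the sister crux `SpinMonotone`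
(antitonicity of `s ↦ ‖A_v(s)‖` on `[0, 3/2]`; `aprioriModeBound_of_spinMonotone` below, sorry-free), and it is the
`ε = 1` instance of the crux itself (`aprioriModeBound_of_arrivalFlattening`): the common, strictly weaker input.
Content on its own: the spin-`5/8` mode of the first-arrival law has no exact (or super-polynomially deep) zero at a
deep vertex unless the spin-`11/8` mode vanishes with it. -/
def AprioriModeBound : Prop := ∃ K R₁ : ℝ, 0 ≤ K ∧ FlatAtDepth K R₁

/-- **(G) Geometric flattening from an a-priori bound** (the STEP of the bootstrap; the analytic heart): for
every level `K ≥ 0` there are a gain `θ ∈ [0, 1)`, a scale factor `b > 1` and a threshold `R₀ > 0` such that,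
whenever the a-priori bound with constant `K` holds at some depth `R ≥ R₀`, flattening holds with constant
`K θ^k` at depth `b^k R` for every `k : ℕ` — each further scale of depth gains the fixed factor `θ`, starting from
wherever the a-priori bound is available.  This is the POWER-LAW RATE of flattening
(`sup-ratio(R') = O(R'^{-κ})`, `κ = log(1/θ)/log b`) in the form that consumes (B); it is implied by the plain
power-law bound (`geometricFlattening_of_powerLaw` below, sorry-free) and, unlike a contraction hypothesis on the
running level `η`, it asks for no lower bound on the sup-ratio.  Route header, TWO-LAYER PLAN: "moduli multiply in
𝓓, ratio ≤ ρ^(#scales)". -/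
def GeometricFlattening : Prop :=
  ∀ K : ℝ, 0 ≤ K → ∃ θ b R₀ : ℝ, 0 ≤ θ ∧ θ < 1 ∧ 1 < b ∧ 0 < R₀ ∧
    ∀ R : ℝ, R₀ ≤ R → FlatAtDepth K R → ∀ k : ℕ, FlatAtDepth (K * θ ^ k) (b ^ k * R)

/-! ## 3. Registered stubs (`sorry` only here) -/

/-- **S1 `stub_aprioriModeBound`** — `AprioriModeBound` (OPEN, conjecture-grade on its own; closes at once, with
`K = 1`, when the sister crux `SpinMonotone` (stmt-CriticalPhenomena-16769, rank 2) closes — see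
`aprioriModeBound_of_spinMonotone`). -/
theorem stub_aprioriModeBound : AprioriModeBound := by
  sorry

/-- **S2 `stub_geometricFlattening`** — `GeometricFlattening` (OPEN, conjecture-grade; the HARDEST stub: a
flattening RATE for the first-arrival winding law of the critical hexagonal SAW, uniformly over simply connected far
fields). -/
theorem stub_geometricFlattening : GeometricFlattening := by
  sorry

/-! ### Name-keyed aliases of the two statements — the hypotheses of `ArrivalFlattening_of`

The skeleton audit (`#h21_check_skeleton`) admits a hypothesis of the skeleton theorem only if its head constant
is a registered obligation or is NAMED like a declared stub; `__Registered.stub_X` is the statement of `stub_X`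
under that name (device of `Cruxes/AxiomsOfLimit/Lines/birth.lean`, `Cruxes/AsymptoticMorera/Lines/birth.lean`).
Each alias is `rfl`-equal to its statement. -/
namespace __Registered

/-- Alias of `AprioriModeBound` keyed by the registered stub name. -/
abbrev stub_aprioriModeBound : Prop := AprioriModeBound
/-- Alias of `GeometricFlattening` keyed by the registered stub name. -/
abbrev stub_geometricFlattening : Prop := GeometricFlattening

end __Registered

/-! ## 4. The sorry-free part: monotonicity, the bootstrap, the composition -/

/-- `FlatAtDepth` is monotone in the constant and in the depth (a deeper ball condition is more restrictive,
so fewer configurations are constrained). [folklore] -/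
theorem flatAtDepth_mono {η η' R R' : ℝ} (hη : η ≤ η') (hR : R ≤ R') (h : FlatAtDepth η R) :
    FlatAtDepth η' R' := by
  intro Λ hΛ a ha v hv hball w₀ w₁ w₂ h₀ h₁ h₂ n₁ n₂ n₃
  have hball' : ∀ w : HexVertex, dist (hexCenter w) (hexCenter v) ≤ R → w ∈ Λ :=
    fun w hw => hball w (hw.trans hR)
  exact (h Λ hΛ a ha v hv hball' w₀ w₁ w₂ h₀ h₁ h₂ n₁ n₂ n₃).trans
    (mul_le_mul_of_nonneg_right hη (norm_nonneg _))

/-- **`flatLimit_of`** — the bootstrap in the line's vocabulary: the a-priori bound (B) at depth `R₁` with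
constant `K`, moved to `R* = max R₀ R₁`, and the geometric rate (G) from level `K` give `FlatAtDepth (K θ^k)
(b^k R*)` for all `k`; choose `k` with `(K + 1) θ^k < ε`. -/
theorem flatLimit_of (hB : AprioriModeBound) (hG : GeometricFlattening) : FlatLimit := by
  obtain ⟨K, R₁, hK, hbase⟩ := hB
  obtain ⟨θ, b, R₀, hθ0, hθ1, hb, hR₀, hstep⟩ := hG K hK
  have hbase' : FlatAtDepth K (max R₀ R₁) := flatAtDepth_mono le_rfl (le_max_right R₀ R₁) hbase
  have hrate : ∀ k : ℕ, FlatAtDepth (K * θ ^ k) (b ^ k * max R₀ R₁) :=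
    hstep (max R₀ R₁) (le_max_left R₀ R₁) hbase'
  intro ε hε
  obtain ⟨k, hk⟩ := exists_pow_lt_of_lt_one (div_pos hε (by linarith : (0 : ℝ) < K + 1)) hθ1
  refine ⟨b ^ k * max R₀ R₁, flatAtDepth_mono ?_ le_rfl (hrate k)⟩
  have hk' : (K + 1) * θ ^ k < ε := by rwa [lt_div_iff₀ (by linarith : (0 : ℝ) < K + 1), mul_comm] at hk
  have hKk : K * θ ^ k ≤ (K + 1) * θ ^ k := mul_le_mul_of_nonneg_right (by linarith) (pow_nonneg hθ0 k)
  exact (hKk.trans hk'.le)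

/-! ## 5. The skeleton theorem: the two stubs imply the crux, BY NAME -/

/-- **`ArrivalFlattening` from the line `birth`** (kernel-checked, no `sorry` of its own): hypotheses = the two
stubs under their registered names; conclusion = the route decl, by name. -/
theorem ArrivalFlattening_of (h1 : __Registered.stub_aprioriModeBound)
    (h2 : __Registered.stub_geometricFlattening) :
    Summit.CriticalPhenomena.SAWScalingLimit.Theses.SAWSpinMonotone.ArrivalFlattening :=
  arrivalFlattening_iff.mpr (flatLimit_of h1 h2)

/-- Wiring check (an `example`, so that `ArrivalFlattening_of` stays the only theorem concluding the crux): the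
registered stubs, with their stated types, feed the skeleton theorem — this term becomes the crux proof when the
two `sorry`s above are discharged. -/
example : Summit.CriticalPhenomena.SAWScalingLimit.Theses.SAWSpinMonotone.ArrivalFlattening :=
  ArrivalFlattening_of stub_aprioriModeBound stub_geometricFlattening

/-! ## 6. Sorry-free sanity theorems about the two stubs (not used by the skeleton theorem) -/

/-- (B) follows from the sister crux `SpinMonotone` (stmt-CriticalPhenomena-16769) with `K = 1` and `R₁ = 0`:
antitonicity on `[0, 3/2]` at the two points `5/8 ≤ 11/8`. -/
theorem aprioriModeBound_of_spinMonotone (hFM : SpinMonotone) : AprioriModeBound := by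
  refine ⟨1, 0, zero_le_one, ?_⟩
  intro Λ hΛ a ha v hv hball w₀ w₁ w₂ h₀ h₁ h₂ n₁ n₂ n₃
  have h := hFM Λ hΛ a ha v hv w₀ w₁ w₂ h₀ h₁ h₂ n₁ n₂ n₃
  have h58 : (5 / 8 : ℝ) ∈ Set.Icc (0 : ℝ) (3 / 2) := ⟨by norm_num, by norm_num⟩
  have h118 : (11 / 8 : ℝ) ∈ Set.Icc (0 : ℝ) (3 / 2) := ⟨by norm_num, by norm_num⟩
  have hle := h h58 h118 (by norm_num)
  simpa [arrivalTransform] using hle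

/-- (B) is also the `ε = 1` instance of the crux (so it is necessary for the crux, not only sufficient with (G)). -/
theorem aprioriModeBound_of_arrivalFlattening (h : ArrivalFlattening) : AprioriModeBound := by
  obtain ⟨R, hR⟩ := arrivalFlattening_iff.mp h 1 one_pos
  exact ⟨1, R, zero_le_one, hR⟩

/-- The plain power-law form of the crux: `sup-ratio(R) ≤ C R^{-κ}` beyond some depth (the expected truth — for
the sister quantity `μ_v` of route SAWDevelopingMap the worst-root numerics give `0.683 R^{-0.760}` to `R = 96`,
`Cruxes/InteriorFlattening/STRATEGY-CENSUS.md` §1, and Coulomb-gas bookkeeping predicts `C/R`,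
`Cruxes/InteriorFlattening/Disproof.lean` §C3). -/
def PowerLawFlattening : Prop :=
  ∃ C κ R₀ : ℝ, 0 < κ ∧ 0 < R₀ ∧ ∀ R : ℝ, R₀ ≤ R → FlatAtDepth (C * R ^ (-κ)) R

/-- (G) is IMPLIED by the plain power-law bound (with `b = 2`, `θ = 2^{-κ}`, `R₀` so large that
`|C| R₀^{-κ} ≤ K`; the a-priori hypothesis is not even used when `K > 0`): (G) asks for no lower bound on, and no
regularity of, the sup-ratio. -/
theorem geometricFlattening_of_powerLaw (h : PowerLawFlattening) : GeometricFlattening := by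
  obtain ⟨C, κ, R₀, hκ, hR₀, h⟩ := h
  intro K hK
  rcases hK.eq_or_lt with rfl | hKpos
  · -- `K = 0`: `FlatAtDepth 0 R` propagates to every larger depth
    refine ⟨1 / 2, 2, 1, by norm_num, by norm_num, by norm_num, by norm_num, ?_⟩
    intro R hR h0 k
    have hRk : R ≤ 2 ^ k * R := le_mul_of_one_le_left (by linarith) (one_le_pow₀ (by norm_num))
    simpa using flatAtDepth_mono (le_refl (0 : ℝ)) hRk h0
  · -- `K > 0`
    have hev : ∀ᶠ R : ℝ in Filter.atTop, |C| * R ^ (-κ) ≤ K := by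
      have ht : Filter.Tendsto (fun R : ℝ => |C| * R ^ (-κ)) Filter.atTop (nhds (|C| * 0)) :=
        (tendsto_rpow_neg_atTop hκ).const_mul |C|
      rw [mul_zero] at ht
      exact ht.eventually (eventually_le_nhds hKpos)
    obtain ⟨R₁, hR₁⟩ := Filter.eventually_atTop.1 hev
    refine ⟨(2 : ℝ) ^ (-κ), 2, max R₀ (max R₁ 1), Real.rpow_nonneg (by norm_num) _,
      Real.rpow_lt_one_of_one_lt_of_neg (by norm_num) (by linarith), by norm_num,
      lt_of_lt_of_le one_pos ((le_max_right _ _).trans (le_max_right _ _)), ?_⟩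
    intro R hR hflat k
    have hRR₀ : R₀ ≤ R := (le_max_left _ _).trans hR
    have hRR₁ : R₁ ≤ R := ((le_max_left _ _).trans (le_max_right _ _)).trans hR
    have hR1 : 1 ≤ R := ((le_max_right _ _).trans (le_max_right _ _)).trans hR
    have hRpos : 0 < R := by linarith
    have h2k : (1 : ℝ) ≤ 2 ^ k := one_le_pow₀ (by norm_num)
    have hdeep : R₀ ≤ 2 ^ k * R := hRR₀.trans (le_mul_of_one_le_left hRpos.le h2k)
    refine flatAtDepth_mono ?_ le_rfl (h (2 ^ k * R) hdeep)
    have hsplit : ((2 : ℝ) ^ k * R) ^ (-κ) = ((2 : ℝ) ^ (-κ)) ^ k * R ^ (-κ) := by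
      rw [Real.mul_rpow (by positivity) hRpos.le, ← Real.rpow_natCast (2 : ℝ) k,
        ← Real.rpow_mul (by norm_num), mul_comm (k : ℝ) (-κ), Real.rpow_mul_natCast (by norm_num)]
    calc C * ((2 : ℝ) ^ k * R) ^ (-κ)
        ≤ |C| * ((2 : ℝ) ^ k * R) ^ (-κ) :=
          mul_le_mul_of_nonneg_right (le_abs_self C) (Real.rpow_nonneg (by positivity) _)
      _ = ((2 : ℝ) ^ (-κ)) ^ k * (|C| * R ^ (-κ)) := by rw [hsplit]; ring
      _ ≤ ((2 : ℝ) ^ (-κ)) ^ k * K :=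
          mul_le_mul_of_nonneg_left (hR₁ R hRR₁) (pow_nonneg (Real.rpow_nonneg (by norm_num) _) k)
      _ = K * ((2 : ℝ) ^ (-κ)) ^ k := mul_comm _ _

end Summit.CriticalPhenomena.SAWScalingLimit.Cruxes.ArrivalFlattening.Birth

end
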